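import Literature.Probability.LatticeModels.WeightedGaussianDomination
import HarnessLib

/-!
# The infrared bound for reflection-positive translation-invariant pair interactions on the
# even torus: `Ŝ⁽ᴸ⁾(p) ≤ 1/(β E_J(p))`, `E_J(p) = ∑_w J_{0,w}(1 - cos p·w)`
# (Fröhlich–Simon–Spencer / Fröhlich–Israel–Lieb–Simon; Panis 2023, Proposition 3.4 with the
# Fröhlich–Simon–Spencer constant)

Topic `Probability/LatticeModels`, namespace `Literature.Probability.LatticeModels`. Sequel of
`WeightedGaussianDomination.lean` (Gaussian domination `Z_J(h) ≤ Z_J(0)` for reflection-positive pair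
interactions on `(ℤ/Lℤ)^d`) and the pair-interaction analogue of `GaussianDomination.lean`'s
`infraredBound_of_gaussianDomination` (Friedli–Velenik 2017, Thm. 10.24 from Prop. 10.27, pp. 506–507,
`N = 1`). For a translation-invariant coupling `J_{x,y} = j(y-x)` with `j` even and nonnegative:

1. the weighted Dirichlet form `𝓔_J` is bilinear, symmetric and nonnegative (`wGradForm_*`), and the
   second-order consequence of Gaussian domination holds: **`β∑_σw(σ)𝓔_J(σ,h)² ≤ 𝓔_J(h,h)∑_σw(σ)`**
   with `w(σ) = e^{-(β/2)𝓔_J(σ,σ)}` (`sum_weight_wGradForm_sq_le`; spin-flip symmetry and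
   `cosh x ≥ 1 + x²/2`, then a first-order expansion — the proof of `GaussianDomination.lean` verbatim);
2. plane waves: **`𝓔_J(σ, χ_k) = E_J(k)Ŝ_k(σ)`** and **`½∑_{x,y}J_{x,y}‖χ_k(x)-χ_k(y)‖² = L^dE_J(k)`**
   with `E_J(k) = ∑_w j(w)(1 - Re χ_k(w))` (`couplingGap`; `= |J|(1-Ĵ(p_k))` in Panis's notation,
   Remark 3.5) and `Ŝ_k(σ) = ∑_xσ_xχ_k(x)` (`wGradFormC_torusChar`, `wGradNormSq_torusChar`);
3. the `w`-weighted torus state `⟨F⟩_{J,β} = ∑_σw(σ)F(σ)/∑_σw(σ)` (`wExpect`; this IS the Gibbs state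
   of the Hamiltonian `-∑_{{x,y}}J_{x,y}σ_xσ_y` on the torus, the constant `e^{-β∑J}` cancelling), its
   translation invariance, and `⟨|Ŝ_k|²⟩ = L^d ∑_z⟨σ₀σ_z⟩Re χ_k(z)` (`sum_weight_norm_spinMode_sq_w`);
4. **`wInfraredBound`** — for `L` even, `L ≥ 4`, `β > 0`, `j ≥ 0` even, `J` reflection positive through
   the bond mirrors (invariance and positive semidefinite crossing kernels, the hypotheses of
   `wGaussZ_le_wGaussZ_zero`) and `E_J(k) > 0`:
   `∑_{z∈𝕋_L} ⟨σ₀σ_z⟩_{J,β} cos(p_k·z) ≤ 1/(β E_J(k))`.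
   This is Panis 2023's Proposition 3.4 (`Ŝ⁽ᴸ⁾(p) ≤ 1/(2β|J|(1-Ĵ(p)))` AS PRINTED) with the
   Fröhlich–Simon–Spencer constant `1/(β|J|(1-Ĵ(p)))` — the printed `2β` being off by a factor `2`
   (see `LongRangeTrivialityOnZ3InfraredBoundLowDim.lean`'s module docstring for the nearest-neighbour
   counterexamples); for nearest-neighbour `j` one has `E_J = 2ε` and this is the tree's `infraredBound`.

Not here: the verification of reflection positivity for a concrete `j` (e.g. the periodised
`C₀|w|₁^{-d-α}` of Panis's example (iii)), and the passage to the infinite-volume state.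

## References

* S. Friedli, Y. Velenik, *Statistical Mechanics of Lattice Systems*, CUP (2017), Thm. 10.24 and its
  proof (pp. 502, 506–507), (10.38) (p. 499), Prop. 10.27 [FriedliVelenik2017] (held; read).
* R. Panis, arXiv:2309.05797 (2023) = Ann. Probab. 54 (2026), §3.3: the displays defining `Ŝ⁽ᴸ⁾` and
  `τ̂(p)`, Proposition 3.4, Remark 3.5 [Panis2023Triviality] (held; pp. 13–14 read).
* J. Fröhlich, B. Simon, T. Spencer, Comm. Math. Phys. 50 (1976) 79–95, Thm. 3.1
  [FrohlichSimonSpencer1976]; J. Fröhlich, R. Israel, E. H. Lieb, B. Simon, Comm. Math. Phys. 62 (1978)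
  [FILS1978] (as cited by Friedli–Velenik and Panis; not consulted).
-/

noncomputable section

open MeasureTheory Filter Topology Finset Complex
open scoped ComplexConjugate Real

namespace Literature.Probability.LatticeModels

/-! ### The weighted Dirichlet form: bilinearity, positivity, complexification -/

section Form

variable {V : Type*} [Fintype V] (J : V → V → ℝ)

/-- `𝓔_J` is symmetric. [folklore] -/
theorem wGradForm_comm (f g : V → ℝ) : wGradForm J f g = wGradForm J g f := by
  unfold wGradForm
  congr 1
  exact Finset.sum_congr rfl fun x _ => Finset.sum_congr rfl fun y _ => by ring

/-- `𝓔_J` is additive in the first argument. [folklore] -/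
theorem wGradForm_add_left (f₁ f₂ g : V → ℝ) :
    wGradForm J (f₁ + f₂) g = wGradForm J f₁ g + wGradForm J f₂ g := by
  unfold wGradForm
  rw [← add_div, ← Finset.sum_add_distrib]
  congr 1
  refine Finset.sum_congr rfl fun x _ => ?_
  rw [← Finset.sum_add_distrib]
  exact Finset.sum_congr rfl fun y _ => by simp only [Pi.add_apply]; ring

/-- `𝓔_J` is homogeneous in the first argument. [folklore] -/
theorem wGradForm_smul_left (t : ℝ) (f g : V → ℝ) :
    wGradForm J (t • f) g = t * wGradForm J f g := by
  unfold wGradForm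
  rw [mul_div_assoc', Finset.mul_sum]
  congr 1
  refine Finset.sum_congr rfl fun x _ => ?_
  rw [Finset.mul_sum]
  exact Finset.sum_congr rfl fun y _ => by simp only [Pi.smul_apply, smul_eq_mul]; ring

/-- `𝓔_J(-f,g) = -𝓔_J(f,g)`. [folklore] -/
theorem wGradForm_neg_left (f g : V → ℝ) : wGradForm J (-f) g = -wGradForm J f g := by
  rw [show -f = (-1 : ℝ) • f by simp, wGradForm_smul_left]; ring

/-- `𝓔_J(s + th, s + th) = 𝓔_J(s,s) + 2t𝓔_J(s,h) + t²𝓔_J(h,h)`. [folklore] -/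
theorem wGradForm_add_smul_self (s h : V → ℝ) (t : ℝ) :
    wGradForm J (s + t • h) (s + t • h) =
      wGradForm J s s + 2 * t * wGradForm J s h + t ^ 2 * wGradForm J h h := by
  have e1 : wGradForm J (t • h) s = t * wGradForm J h s := wGradForm_smul_left J t h s
  have e2 : wGradForm J s (t • h) = t * wGradForm J s h := by
    rw [wGradForm_comm, wGradForm_smul_left, wGradForm_comm]
  have e3 : wGradForm J (t • h) (t • h) = t * (t * wGradForm J h h) := by
    rw [wGradForm_smul_left, wGradForm_comm, wGradForm_smul_left]
  rw [wGradForm_add_left, wGradForm_comm J s (s + t • h), wGradForm_comm J (t • h) (s + t • h),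
    wGradForm_add_left, wGradForm_add_left, e1, e2, e3, wGradForm_comm J h s]
  ring

/-- `𝓔_J(f,f) ≥ 0` for `J ≥ 0`. [folklore] -/
theorem wGradForm_self_nonneg (hJ : ∀ x y, 0 ≤ J x y) (f : V → ℝ) : 0 ≤ wGradForm J f f := by
  unfold wGradForm
  refine div_nonneg (Finset.sum_nonneg fun x _ => Finset.sum_nonneg fun y _ => ?_) zero_le_two
  have := hJ x y
  nlinarith

/-- The complexified form `½∑_{x,y}J_{x,y}(f_x - f_y)(g_x - g_y)` for real `f` and complex `g`
(Friedli–Velenik 2017, proof of Thm. 10.24: "it also extends to any `h ∈ (ℂ^ν)^{𝕋_L}`").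
[cite: FriedliVelenik2017, §10.5.3, proof of Thm. 10.24] -/
def wGradFormC (f : V → ℝ) (g : V → ℂ) : ℂ :=
  (∑ x, ∑ y, (J x y : ℂ) * (((f x - f y : ℝ)) * (g x - g y))) / 2

/-- `½∑_{x,y}J_{x,y}‖g_x - g_y‖²` for complex `g`. [cite: FriedliVelenik2017, §10.5.3, proof of Thm. 10.24] -/
def wGradNormSq (g : V → ℂ) : ℝ := (∑ x, ∑ y, J x y * ‖g x - g y‖ ^ 2) / 2

/-- Real part of the complexified form. [folklore] -/
theorem wGradFormC_re (f : V → ℝ) (g : V → ℂ) :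
    (wGradFormC J f g).re = wGradForm J f (fun x => (g x).re) := by
  unfold wGradFormC wGradForm
  have h2 : ((∑ x, ∑ y, (J x y : ℂ) * (((f x - f y : ℝ)) * (g x - g y))) / 2).re =
      (∑ x, ∑ y, (J x y : ℂ) * (((f x - f y : ℝ)) * (g x - g y))).re / 2 := by
    rw [show (2 : ℂ) = ((2 : ℝ) : ℂ) by norm_num, Complex.div_ofReal_re]
  rw [h2, Complex.re_sum]
  congr 1
  refine Finset.sum_congr rfl fun x _ => ?_
  rw [Complex.re_sum]
  refine Finset.sum_congr rfl fun y _ => ?_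
  rw [Complex.re_ofReal_mul, Complex.re_ofReal_mul, Complex.sub_re]

/-- Imaginary part of the complexified form. [folklore] -/
theorem wGradFormC_im (f : V → ℝ) (g : V → ℂ) :
    (wGradFormC J f g).im = wGradForm J f (fun x => (g x).im) := by
  unfold wGradFormC wGradForm
  have h2 : ((∑ x, ∑ y, (J x y : ℂ) * (((f x - f y : ℝ)) * (g x - g y))) / 2).im =
      (∑ x, ∑ y, (J x y : ℂ) * (((f x - f y : ℝ)) * (g x - g y))).im / 2 := by
    rw [show (2 : ℂ) = ((2 : ℝ) : ℂ) by norm_num, Complex.div_ofReal_im]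
  rw [h2, Complex.im_sum]
  congr 1
  refine Finset.sum_congr rfl fun x _ => ?_
  rw [Complex.im_sum]
  refine Finset.sum_congr rfl fun y _ => ?_
  rw [Complex.im_ofReal_mul, Complex.im_ofReal_mul, Complex.sub_im]

/-- `½∑J‖g_x-g_y‖² = 𝓔_J(Re g, Re g) + 𝓔_J(Im g, Im g)`. [folklore] -/
theorem wGradNormSq_eq (g : V → ℂ) :
    wGradNormSq J g = wGradForm J (fun x => (g x).re) (fun x => (g x).re) +
      wGradForm J (fun x => (g x).im) (fun x => (g x).im) := by
  unfold wGradNormSq wGradForm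
  rw [← add_div, ← Finset.sum_add_distrib]
  congr 1
  refine Finset.sum_congr rfl fun x _ => ?_
  rw [← Finset.sum_add_distrib]
  refine Finset.sum_congr rfl fun y _ => ?_
  rw [← Complex.normSq_eq_norm_sq, Complex.normSq_apply, Complex.sub_re, Complex.sub_im]
  ring

end Form

/-! ### The second-order consequence of Gaussian domination -/

section SecondOrder

variable {V : Type*} [Fintype V] [DecidableEq V] (J : V → V → ℝ)

/-- `Z_J(th)` expanded around the spin configuration: with `w(σ) = e^{-(β/2)𝓔_J(σ,σ)}` and
`A_h(σ) = 𝓔_J(σ,h)`, `Z_J(th) = e^{-(β/2)t²𝓔_J(h,h)} ∑_σ w(σ) e^{-βtA_h(σ)}`.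
[cite: FriedliVelenik2017, §10.5.3, proof of Thm. 10.24 ("elementary computations")] -/
theorem wGaussZ_smul (β t : ℝ) (h : V → ℝ) :
    wGaussZ J β (t • h) = Real.exp (-(β / 2) * t ^ 2 * wGradForm J h h) *
      ∑ σ : V → ℤˣ, Real.exp (-(β / 2) * wGradForm J (fun x => spinAt x σ) (fun x => spinAt x σ)) *
        Real.exp (-β * t * wGradForm J (fun x => spinAt x σ) h) := by
  unfold wGaussZ
  rw [Finset.mul_sum]
  refine Finset.sum_congr rfl fun σ _ => ?_
  have hfun : (fun x => spinAt x σ + (t • h) x) = (fun x => spinAt x σ) + t • h := by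
    funext x; simp
  rw [hfun, wGradForm_add_smul_self, ← Real.exp_add, ← Real.exp_add]
  congr 1
  ring

/-- Spin-flip symmetry: `∑_σ w(σ)e^{-cA_h(σ)} = ∑_σ w(σ)cosh(cA_h(σ))` (`w(-σ) = w(σ)`, `A_h(-σ) = -A_h(σ)`).
[folklore] -/
theorem sum_weight_exp_eq_sum_weight_cosh_w (β c : ℝ) (h : V → ℝ) :
    ∑ σ : V → ℤˣ, Real.exp (-(β / 2) * wGradForm J (fun x => spinAt x σ) (fun x => spinAt x σ)) *
        Real.exp (-c * wGradForm J (fun x => spinAt x σ) h) =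
      ∑ σ : V → ℤˣ, Real.exp (-(β / 2) * wGradForm J (fun x => spinAt x σ) (fun x => spinAt x σ)) *
        Real.cosh (c * wGradForm J (fun x => spinAt x σ) h) := by
  set w : (V → ℤˣ) → ℝ := fun σ =>
    Real.exp (-(β / 2) * wGradForm J (fun x => spinAt x σ) (fun x => spinAt x σ)) with hw
  set A : (V → ℤˣ) → ℝ := fun σ => wGradForm J (fun x => spinAt x σ) h with hA
  have hwneg : ∀ σ, w (-σ) = w σ := fun σ => by
    simp only [hw]
    have : (fun x => spinAt x (-σ)) = -fun x => spinAt x σ := by funext x; simp [spinAt_neg_cfg]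
    rw [this, wGradForm_neg_left, wGradForm_comm, wGradForm_neg_left, neg_neg]
  have hAneg : ∀ σ, A (-σ) = -A σ := fun σ => by
    simp only [hA]
    have : (fun x => spinAt x (-σ)) = -fun x => spinAt x σ := by funext x; simp [spinAt_neg_cfg]
    rw [this, wGradForm_neg_left]
  -- reindex by `σ ↦ -σ`
  have hflip : ∑ σ, w σ * Real.exp (-c * A σ) = ∑ σ, w σ * Real.exp (c * A σ) := by
    rw [← Equiv.sum_comp (Equiv.neg (V → ℤˣ)) (fun σ => w σ * Real.exp (-c * A σ))]
    refine Finset.sum_congr rfl fun σ _ => ?_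
    simp only [Equiv.neg_apply, hwneg, hAneg]
    ring_nf
  show ∑ σ, w σ * Real.exp (-c * A σ) = ∑ σ, w σ * Real.cosh (c * A σ)
  have h2 : ∑ σ, w σ * Real.exp (-c * A σ) + ∑ σ, w σ * Real.exp (c * A σ) =
      2 * ∑ σ, w σ * Real.cosh (c * A σ) := by
    rw [Finset.mul_sum, ← Finset.sum_add_distrib]
    refine Finset.sum_congr rfl fun σ _ => ?_
    rw [Real.cosh_eq, neg_mul]
    ring
  linarith

/-- **The second-order consequence of Gaussian domination for a pair interaction**: if
`Z_J(th) ≤ Z_J(0)` for all real `t`, `β > 0` and `J ≥ 0`, then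
`β∑_σw(σ)𝓔_J(σ,h)² ≤ 𝓔_J(h,h)∑_σw(σ)`, `w(σ) = e^{-(β/2)𝓔_J(σ,σ)}` (Friedli–Velenik 2017, (10.46)–(10.47),
weighted). [cite: FriedliVelenik2017, §10.5.3, proof of Thm. 10.24, (10.46)–(10.47)] -/
theorem sum_weight_wGradForm_sq_le (hJ : ∀ x y, 0 ≤ J x y) {β : ℝ} (hβ : 0 < β) (h : V → ℝ)
    (hGD : ∀ t : ℝ, wGaussZ J β (t • h) ≤ wGaussZ J β 0) :
    β * ∑ σ : V → ℤˣ, Real.exp (-(β / 2) * wGradForm J (fun x => spinAt x σ) (fun x => spinAt x σ)) *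
        wGradForm J (fun x => spinAt x σ) h ^ 2 ≤
      wGradForm J h h *
        ∑ σ : V → ℤˣ, Real.exp (-(β / 2) * wGradForm J (fun x => spinAt x σ) (fun x => spinAt x σ)) := by
  set w : (V → ℤˣ) → ℝ := fun σ =>
    Real.exp (-(β / 2) * wGradForm J (fun x => spinAt x σ) (fun x => spinAt x σ)) with hw
  set A : (V → ℤˣ) → ℝ := fun σ => wGradForm J (fun x => spinAt x σ) h with hA
  set B : ℝ := wGradForm J h h with hB
  set Z₀ : ℝ := ∑ σ, w σ with hZ₀
  set S : ℝ := ∑ σ, w σ * A σ ^ 2 with hS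
  show β * S ≤ B * Z₀
  have hw_pos : ∀ σ, 0 < w σ := fun σ => Real.exp_pos _
  have hZ₀_pos : 0 < Z₀ := Finset.sum_pos (fun σ _ => hw_pos σ) Finset.univ_nonempty
  have hS0 : 0 ≤ S := Finset.sum_nonneg fun σ _ => mul_nonneg (hw_pos σ).le (sq_nonneg _)
  have hB0 : 0 ≤ B := wGradForm_self_nonneg J hJ h
  have hZ0 : wGaussZ J β 0 = Z₀ := by
    have := wGaussZ_smul J β 0 h
    rw [zero_smul] at this
    rw [this]
    simp [hZ₀, hw]
  -- the lower bound `Z(th) ≥ e^{-(β/2)t²B} (Z₀ + (β² t²/2) S)`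
  have hlow : ∀ t : ℝ, Real.exp (-(β / 2) * t ^ 2 * B) * (Z₀ + β ^ 2 * t ^ 2 / 2 * S) ≤
      wGaussZ J β (t • h) := by
    intro t
    rw [wGaussZ_smul, show -β * t = -(β * t) by ring, sum_weight_exp_eq_sum_weight_cosh_w]
    refine mul_le_mul_of_nonneg_left ?_ (Real.exp_pos _).le
    calc Z₀ + β ^ 2 * t ^ 2 / 2 * S = ∑ σ, w σ * (1 + (β * t * A σ) ^ 2 / 2) := by
          rw [hZ₀, hS, Finset.mul_sum, ← Finset.sum_add_distrib]
          refine Finset.sum_congr rfl fun σ _ => ?_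
          ring
      _ ≤ ∑ σ, w σ * Real.cosh (β * t * A σ) :=
          Finset.sum_le_sum fun σ _ =>
            mul_le_mul_of_nonneg_left (one_add_sq_div_two_le_cosh _) (hw_pos σ).le
  -- hence `Z₀ + (β²/2) S u ≤ Z₀ e^{(β/2)Bu}` for `u ≥ 0`
  have hphi : ∀ u : ℝ, 0 ≤ u → Z₀ + β ^ 2 / 2 * S * u ≤ Z₀ * Real.exp (β / 2 * B * u) := by
    intro u hu
    have h1 := (hlow (Real.sqrt u)).trans ((hGD _).trans_eq hZ0)
    rw [Real.sq_sqrt hu] at h1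
    have hexp : Real.exp (-(β / 2) * u * B) * Real.exp (β / 2 * B * u) = 1 := by
      rw [← Real.exp_add]; convert Real.exp_zero using 2; ring
    have h2 := mul_le_mul_of_nonneg_right h1 (Real.exp_pos (β / 2 * B * u)).le
    calc Z₀ + β ^ 2 / 2 * S * u
        = (Z₀ + β ^ 2 * u / 2 * S) * (Real.exp (-(β / 2) * u * B) * Real.exp (β / 2 * B * u)) := by
          rw [hexp]; ring
      _ = Real.exp (-(β / 2) * u * B) * (Z₀ + β ^ 2 * u / 2 * S) * Real.exp (β / 2 * B * u) := by
          ring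
      _ ≤ Z₀ * Real.exp (β / 2 * B * u) := h2
  -- first-order expansion at `u = 0`
  by_contra hcon
  push Not at hcon
  set c : ℝ := β / 2 * B with hc
  have hlt : Z₀ * c < β ^ 2 / 2 * S := by
    rw [hc]; nlinarith
  have hderiv : HasDerivAt (fun u : ℝ => Z₀ * Real.exp (c * u)) (Z₀ * c) 0 := by
    have h1 : HasDerivAt (fun u : ℝ => c * u) c 0 := by
      simpa using (hasDerivAt_id (0 : ℝ)).const_mul c
    have h2 := (Real.hasDerivAt_exp (c * 0)).comp 0 h1
    simp only [mul_zero, Real.exp_zero, one_mul] at h2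
    simpa using h2.const_mul Z₀
  rw [hasDerivAt_iff_tendsto_slope_zero] at hderiv
  have hev : ∀ᶠ u : ℝ in 𝓝[>] 0, u⁻¹ * (Z₀ * Real.exp (c * u) - Z₀) < β ^ 2 / 2 * S := by
    have ht := hderiv.mono_left (nhdsGT_le_nhdsNE 0)
    simp only [zero_add, mul_zero, Real.exp_zero, mul_one, smul_eq_mul] at ht
    exact ht.eventually (gt_mem_nhds hlt)
  obtain ⟨u, hu, hupos⟩ := (hev.and self_mem_nhdsWithin).exists
  have hupos' : (0 : ℝ) < u := hupos
  have h3 := hphi u hupos'.le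
  have h4 : Z₀ * Real.exp (c * u) - Z₀ < β ^ 2 / 2 * S * u := by
    have := (inv_mul_lt_iff₀ hupos').1 hu
    linarith
  rw [hc] at h4
  have : β / 2 * B * u = (β / 2 * B) * u := by ring
  rw [this] at h3
  linarith

end SecondOrder

/-! ### Translation-invariant couplings on the torus: `E_J(k)`, plane waves, the `w`-state -/

section Torus

variable {d L : ℕ} [NeZero L]

/-- The coupling matrix of a translation-invariant pair interaction on the torus, `J_{x,y} = j(y - x)`
(Panis 2023, (A3): "`J_{x,y} = J_{0,y-x}`"). [cite: Panis2023Triviality, §1.2.1 ((A3) translation invariant)] -/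
def convCoupling (j : TorusSite d L → ℝ) (x y : TorusSite d L) : ℝ := j (y - x)

/-- **`E_J(k) = ∑_w j(w)(1 - Re χ_k(w)) = ∑_w J_{0,w}(1 - cos(p_k·w))`** — Panis's `|J|(1 - Ĵ(p))`
(Remark 3.5: "`|J|(1-Ĵ(p)) = 2∑_x sin²(p·x/2)J_{0,x}`"), the Fourier symbol of the coupling Laplacian.
[cite: Panis2023Triviality, Proposition 3.4 (definition of Ĵ) and Remark 3.5] -/
def couplingGap (j : TorusSite d L → ℝ) (k : TorusSite d L) : ℝ := ∑ w, j w * (1 - (torusChar k w).re)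

variable (j : TorusSite d L → ℝ)

/-- `E_J(k) ≥ 0` for `j ≥ 0`. [folklore] -/
theorem couplingGap_nonneg (hj0 : ∀ w, 0 ≤ j w) (k : TorusSite d L) : 0 ≤ couplingGap j k := by
  refine Finset.sum_nonneg fun w _ => mul_nonneg (hj0 w) ?_
  have : (torusChar k w).re ≤ 1 := (Complex.re_le_norm _).trans (norm_torusChar k w).le
  linarith

/-- For an even `j`, `∑_w j(w)(1 - χ_k(w))` is real and equals `E_J(k)` (pair `w` with `-w`:
`χ_k(-w) = conj χ_k(w)`). [cite: Panis2023Triviality, Remark 3.5] -/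
theorem sum_mul_one_sub_torusChar (hje : ∀ w, j (-w) = j w) (k : TorusSite d L) :
    ∑ w, (j w : ℂ) * (1 - torusChar k w) = (couplingGap j k : ℂ) := by
  set S : ℂ := ∑ w, (j w : ℂ) * (1 - torusChar k w) with hS
  have hconj : conj S = S := by
    rw [hS, map_sum, ← Equiv.sum_comp (Equiv.neg (TorusSite d L))]
    refine Finset.sum_congr rfl fun w _ => ?_
    simp only [Equiv.neg_apply, map_mul, Complex.conj_ofReal, map_sub, map_one, hje,
      torusChar_neg_right, Complex.conj_conj]
  have hre : (S.re : ℂ) = S := Complex.conj_eq_iff_re.1 hconj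
  rw [← hre]
  congr 1
  rw [hS, Complex.re_sum, couplingGap]
  refine Finset.sum_congr rfl fun w _ => ?_
  rw [Complex.re_ofReal_mul, Complex.sub_re, Complex.one_re]

/-- **`𝓔_J(f, g) = ∑_x f_x ∑_w j(w)(g_x - g_{x+w})`** for `J_{x,y} = j(y-x)`, `j` even (complex `g`).
[folklore] -/
theorem wGradFormC_convCoupling (hje : ∀ w, j (-w) = j w) (f : TorusSite d L → ℝ) (g : TorusSite d L → ℂ) :
    wGradFormC (convCoupling j) f g = ∑ x, (f x : ℂ) * ∑ w, (j w : ℂ) * (g x - g (x + w)) := by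
  unfold wGradFormC convCoupling
  -- reindex the inner sum by `y = x + w`
  have hinner : ∀ x, ∑ y, (j (y - x) : ℂ) * (((f x - f y : ℝ)) * (g x - g y)) =
      ∑ w, (j w : ℂ) * (((f x - f (x + w) : ℝ)) * (g x - g (x + w))) := by
    intro x
    rw [← Equiv.sum_comp (Equiv.addLeft x)]
    exact Finset.sum_congr rfl fun w _ => by simp
  simp_rw [hinner]
  -- the four terms: `∑_x∑_w j(w) f_x (g_x - g_{x+w})` appears twice
  have hswap : ∑ x, ∑ w, (j w : ℂ) * ((f (x + w) : ℂ) * (g x - g (x + w))) =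
      -∑ x, ∑ w, (j w : ℂ) * ((f x : ℂ) * (g x - g (x + w))) := by
    rw [← Finset.sum_neg_distrib]
    -- substitute `x' = x + w`, `w' = -w`
    calc ∑ x, ∑ w, (j w : ℂ) * ((f (x + w) : ℂ) * (g x - g (x + w)))
        = ∑ w, ∑ x, (j w : ℂ) * ((f (x + w) : ℂ) * (g x - g (x + w))) := Finset.sum_comm
      _ = ∑ w, ∑ x, (j w : ℂ) * ((f x : ℂ) * (g (x - w) - g x)) := by
          refine Finset.sum_congr rfl fun w _ => ?_
          rw [← Equiv.sum_comp (Equiv.addRight w) (fun x => (j w : ℂ) * ((f x : ℂ) * (g (x - w) - g x)))]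
          exact Finset.sum_congr rfl fun x _ => by simp
      _ = ∑ w, ∑ x, (j w : ℂ) * ((f x : ℂ) * (g (x + w) - g x)) := by
          rw [← Equiv.sum_comp (Equiv.neg (TorusSite d L))]
          refine Finset.sum_congr rfl fun w _ => Finset.sum_congr rfl fun x _ => ?_
          simp only [Equiv.neg_apply, hje, sub_neg_eq_add]
      _ = ∑ x, ∑ w, (j w : ℂ) * ((f x : ℂ) * (g (x + w) - g x)) := Finset.sum_comm
      _ = ∑ x, -∑ w, (j w : ℂ) * ((f x : ℂ) * (g x - g (x + w))) := by
          refine Finset.sum_congr rfl fun x _ => ?_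
          rw [← Finset.sum_neg_distrib]
          exact Finset.sum_congr rfl fun w _ => by ring
  have hsplit : ∑ x, ∑ w, (j w : ℂ) * (((f x - f (x + w) : ℝ)) * (g x - g (x + w))) =
      ∑ x, ∑ w, (j w : ℂ) * ((f x : ℂ) * (g x - g (x + w))) -
        ∑ x, ∑ w, (j w : ℂ) * ((f (x + w) : ℂ) * (g x - g (x + w))) := by
    rw [← Finset.sum_sub_distrib]
    refine Finset.sum_congr rfl fun x _ => ?_
    rw [← Finset.sum_sub_distrib]
    exact Finset.sum_congr rfl fun w _ => by push_cast; ring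
  rw [hsplit, hswap, sub_neg_eq_add, ← two_mul, mul_div_cancel_left₀ _ two_ne_zero]
  refine Finset.sum_congr rfl fun x _ => ?_
  rw [Finset.mul_sum]
  exact Finset.sum_congr rfl fun w _ => by ring

/-- **`𝓔_J(σ, χ_k) = E_J(k) Ŝ_k(σ)`** for `J_{x,y} = j(y-x)`, `j` even: the Dirichlet form of a spin
configuration against a plane wave is the symbol times the spin Fourier mode (the pair-interaction
version of Friedli–Velenik's `∑_iS_i(-Δα)_i = 2d{1-(2d)⁻¹∑cos}∑_iS_ie^{ip·i}`).
[cite: FriedliVelenik2017, §10.5.3, proof of Thm. 10.24] -/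
theorem wGradFormC_torusChar (hje : ∀ w, j (-w) = j w) (k : TorusSite d L)
    (σ : SpinConfig (TorusSite d L)) :
    wGradFormC (convCoupling j) (fun x => spinAt x σ) (torusChar k) =
      (couplingGap j k : ℂ) * spinMode k σ := by
  rw [wGradFormC_convCoupling j hje, spinMode, Finset.mul_sum]
  refine Finset.sum_congr rfl fun x _ => ?_
  have hin : ∑ w, (j w : ℂ) * (torusChar k x - torusChar k (x + w)) =
      torusChar k x * ∑ w, (j w : ℂ) * (1 - torusChar k w) := by
    rw [Finset.mul_sum]
    exact Finset.sum_congr rfl fun w _ => by rw [torusChar_add_right]; ring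
  rw [hin, sum_mul_one_sub_torusChar j hje]
  ring

/-- **`½∑_{x,y}J_{x,y}‖χ_k(x) - χ_k(y)‖² = L^d E_J(k)`** for `J_{x,y} = j(y-x)` (the pair-interaction
version of Friedli–Velenik's `∑_{{i,j}}‖h_i-h_j‖² = 2d|𝕋_L|{1-(2d)⁻¹∑cos}`; `‖1 - u‖² = 2(1 - Re u)` for
`‖u‖ = 1`, as in `Literature.NumberTheory.LFunctions.norm_one_sub_sq_of_norm_one`).
[cite: FriedliVelenik2017, §10.5.3, proof of Thm. 10.24] -/
theorem wGradNormSq_torusChar (k : TorusSite d L) :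
    wGradNormSq (convCoupling j) (torusChar k) = (L : ℝ) ^ d * couplingGap j k := by
  have hnorm : ∀ {u : ℂ}, ‖u‖ = 1 → ‖1 - u‖ ^ 2 = 2 * (1 - u.re) := by
    intro u hu
    rw [← Complex.normSq_eq_norm_sq, Complex.normSq_apply, Complex.sub_re, Complex.sub_im,
      Complex.one_re, Complex.one_im]
    have h := Complex.normSq_eq_norm_sq u
    rw [hu, Complex.normSq_apply] at h
    nlinarith
  unfold wGradNormSq convCoupling
  have hinner : ∀ x : TorusSite d L, ∑ y, j (y - x) * ‖torusChar k x - torusChar k y‖ ^ 2 =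
      2 * couplingGap j k := by
    intro x
    rw [← Equiv.sum_comp (Equiv.addLeft x), couplingGap, Finset.mul_sum]
    refine Finset.sum_congr rfl fun w _ => ?_
    simp only [Equiv.coe_addLeft, add_sub_cancel_left]
    rw [torusChar_add_right, ← mul_one_sub, norm_mul, norm_torusChar, one_mul,
      hnorm (norm_torusChar k w)]
    ring
  simp_rw [hinner]
  rw [Finset.sum_const, Finset.card_univ, Fintype.card_fun, ZMod.card, Fintype.card_fin, nsmul_eq_mul]
  push_cast
  ring

/-! #### The torus Gibbs state as a `w`-weighted average, its translation invariance -/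

/-- The Boltzmann weight `w_J(σ) = e^{-(β/2)𝓔_J(σ,σ)}` (`= e^{-β∑_{{x,y}}J}e^{β∑_{{x,y}}Jσ_xσ_y}`).
[cite: FriedliVelenik2017, §10.5.3, proof of Thm. 10.24] -/
def wWeight (J : TorusSite d L → TorusSite d L → ℝ) (β : ℝ) (σ : SpinConfig (TorusSite d L)) : ℝ :=
  Real.exp (-(β / 2) * wGradForm J (fun x => spinAt x σ) (fun x => spinAt x σ))

/-- **The Gibbs state of the pair interaction `J` on the torus at inverse temperature `β`, zero field**,
as the `w_J`-weighted average `⟨F⟩ = ∑_σw_J(σ)F(σ)/∑_σw_J(σ)` — for `J = J⁽ᴸ⁾` the periodised coupling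
this is Panis's `⟨·⟩_{𝕋_L,J⁽ᴸ⁾,β}` (the constant `e^{-β∑J}` cancels).
[cite: Panis2023Triviality, Definition 3.1 (⟨·⟩_{𝕋_L,ρ,β} = ⟨·⟩_{𝕋_L,ρ,J^{(L)},β}) and §1.2.1] -/
def wExpect (J : TorusSite d L → TorusSite d L → ℝ) (β : ℝ) (F : SpinConfig (TorusSite d L) → ℝ) : ℝ :=
  (∑ σ, wWeight J β σ * F σ) / ∑ σ, wWeight J β σ

/-- The torus two-point function `G_L(z) = ⟨σ₀σ_z⟩_{J,β}`. [cite: Panis2023Triviality, §3.3 (display defining Ŝ^{(L)})] -/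
def wTwoPoint (J : TorusSite d L → TorusSite d L → ℝ) (β : ℝ) (z : TorusSite d L) : ℝ :=
  wExpect J β fun σ => spinAt 0 σ * spinAt z σ

/-- `∑_σ w_J(σ) > 0`. [folklore] -/
theorem sum_wWeight_pos (J : TorusSite d L → TorusSite d L → ℝ) (β : ℝ) : 0 < ∑ σ, wWeight J β σ :=
  Finset.sum_pos (fun _ _ => Real.exp_pos _) Finset.univ_nonempty

/-- The translated configuration `(τ_aσ)_z = σ_{z+a}`. [folklore] -/
def shiftCfg (a : TorusSite d L) : SpinConfig (TorusSite d L) ≃ SpinConfig (TorusSite d L) where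
  toFun σ := fun z => σ (z + a)
  invFun σ := fun z => σ (z - a)
  left_inv σ := by funext z; simp
  right_inv σ := by funext z; simp

/-- The Dirichlet form of a translation-invariant coupling is translation invariant. [folklore] -/
theorem wGradForm_shift (a : TorusSite d L) (σ : SpinConfig (TorusSite d L)) :
    wGradForm (convCoupling j) (fun x => spinAt x (shiftCfg a σ)) (fun x => spinAt x (shiftCfg a σ)) =
      wGradForm (convCoupling j) (fun x => spinAt x σ) (fun x => spinAt x σ) := by
  unfold wGradForm convCoupling
  congr 1
  symm
  rw [← Equiv.sum_comp (Equiv.addRight a)]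
  refine Finset.sum_congr rfl fun x _ => ?_
  rw [← Equiv.sum_comp (Equiv.addRight a)]
  refine Finset.sum_congr rfl fun y _ => ?_
  simp only [Equiv.coe_addRight, add_sub_add_right_eq_sub]
  rfl

/-- **Translation invariance of the torus state**: `⟨σ_xσ_y⟩_{J,β} = ⟨σ₀σ_{y-x}⟩_{J,β}` for
`J_{x,y} = j(y-x)`. [cite: Panis2023Triviality, §3.3 ("In view of the model's translation invariance")] -/
theorem wExpect_pair_eq_wTwoPoint (β : ℝ) (x y : TorusSite d L) :
    wExpect (convCoupling j) β (fun σ => spinAt x σ * spinAt y σ) = wTwoPoint (convCoupling j) β (y - x) := by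
  have hw : ∀ σ, wWeight (convCoupling j) β (shiftCfg x σ) = wWeight (convCoupling j) β σ := fun σ => by
    unfold wWeight; rw [wGradForm_shift]
  unfold wTwoPoint wExpect
  congr 1
  symm
  rw [← Equiv.sum_comp (shiftCfg x)]
  refine Finset.sum_congr rfl fun σ _ => ?_
  rw [hw]
  congr 1
  show spinAt 0 (fun z => σ (z + x)) * spinAt (y - x) (fun z => σ (z + x)) = spinAt x σ * spinAt y σ
  simp only [spinAt, zero_add, sub_add_cancel]

/-- **`∑_σ w(σ)‖Ŝ_k(σ)‖² = (∑_σw(σ)) · L^d ∑_z G_L(z) Re χ_k(z)`** (translation invariance;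
Friedli–Velenik 2017, proof of Thm. 10.24, last display `⟨|∑_iS_ie^{ip·i}|²⟩ = |𝕋_L|∑_je^{ip·j}⟨S₀S_j⟩`).
[cite: FriedliVelenik2017, §10.5.3, proof of Thm. 10.24] -/
theorem sum_weight_norm_spinMode_sq_w (β : ℝ) (k : TorusSite d L) :
    ∑ σ : SpinConfig (TorusSite d L), wWeight (convCoupling j) β σ * ‖spinMode k σ‖ ^ 2 =
      (∑ σ : SpinConfig (TorusSite d L), wWeight (convCoupling j) β σ) *
        ((L : ℝ) ^ d * ∑ z, wTwoPoint (convCoupling j) β z * (torusChar k z).re) := by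
  classical
  set J := convCoupling j with hJ
  set w : SpinConfig (TorusSite d L) → ℝ := wWeight J β with hw
  set W : ℝ := ∑ σ, w σ with hW
  have hWpos : 0 < W := sum_wWeight_pos J β
  -- `‖Ŝ‖² = ∑_{x,y} σ_xσ_y Re(χ_x conj χ_y)`
  have hnorm : ∀ σ, ‖spinMode k σ‖ ^ 2 =
      ∑ x, ∑ y, spinAt x σ * spinAt y σ * (torusChar k x * conj (torusChar k y)).re := by
    intro σ
    have h0 : ‖spinMode k σ‖ ^ 2 = (spinMode k σ * conj (spinMode k σ)).re := by
      rw [Complex.mul_conj, Complex.ofReal_re, Complex.normSq_eq_norm_sq]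
    rw [h0, spinMode, map_sum, Finset.sum_mul_sum, Complex.re_sum]
    refine Finset.sum_congr rfl fun x _ => ?_
    rw [Complex.re_sum]
    refine Finset.sum_congr rfl fun y _ => ?_
    rw [map_mul, Complex.conj_ofReal]
    have : (spinAt x σ : ℂ) * torusChar k x * ((spinAt y σ : ℂ) * conj (torusChar k y)) =
        ((spinAt x σ * spinAt y σ : ℝ) : ℂ) * (torusChar k x * conj (torusChar k y)) := by
      push_cast; ring
    rw [this, Complex.re_ofReal_mul]
  -- `∑_σ w σ_xσ_y = W · G(y - x)`
  have hpair : ∀ x y, ∑ σ, w σ * (spinAt x σ * spinAt y σ) = W * wTwoPoint J β (y - x) := by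
    intro x y
    have h' : wTwoPoint J β (y - x) = (∑ σ, w σ * (spinAt x σ * spinAt y σ)) / W := by
      rw [hJ, ← wExpect_pair_eq_wTwoPoint]; rfl
    rw [h', mul_div_cancel₀ _ hWpos.ne']
  -- `∑_{x,y} χ_x conj χ_y G(y - x) = L^d ∑_z G(z) conj χ(z)`
  have hfourier : ∑ x : TorusSite d L, ∑ y, (wTwoPoint J β (y - x) : ℂ) * (torusChar k x * conj (torusChar k y)) =
      ((L : ℂ) ^ d) * ∑ z, (wTwoPoint J β z : ℂ) * conj (torusChar k z) := by
    have hrow : ∀ x : TorusSite d L, ∑ y, (wTwoPoint J β (y - x) : ℂ) * (torusChar k x * conj (torusChar k y)) =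
        ∑ z, (wTwoPoint J β z : ℂ) * conj (torusChar k z) := by
      intro x
      rw [← Equiv.sum_comp (Equiv.addLeft x)]
      refine Finset.sum_congr rfl fun z _ => ?_
      simp only [Equiv.coe_addLeft, add_sub_cancel_left, torusChar_add_right, map_mul]
      have h1 : torusChar k x * conj (torusChar k x) = 1 := torusChar_mul_conj k x
      calc (wTwoPoint J β z : ℂ) * (torusChar k x * (conj (torusChar k x) * conj (torusChar k z)))
          = (wTwoPoint J β z : ℂ) * conj (torusChar k z) * (torusChar k x * conj (torusChar k x)) := by ring
        _ = (wTwoPoint J β z : ℂ) * conj (torusChar k z) := by rw [h1, mul_one]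
    simp_rw [hrow]
    rw [Finset.sum_const, Finset.card_univ, nsmul_eq_mul, Fintype.card_fun, ZMod.card, Fintype.card_fin]
    push_cast
    ring
  have hre : (∑ z, (wTwoPoint J β z : ℂ) * conj (torusChar k z)).re = ∑ z, wTwoPoint J β z * (torusChar k z).re := by
    rw [Complex.re_sum]
    refine Finset.sum_congr rfl fun z _ => ?_
    rw [Complex.re_ofReal_mul, Complex.conj_re]
  -- assemble
  calc ∑ σ, w σ * ‖spinMode k σ‖ ^ 2
      = ∑ σ, ∑ x, ∑ y, w σ * (spinAt x σ * spinAt y σ) * (torusChar k x * conj (torusChar k y)).re := by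
        refine Finset.sum_congr rfl fun σ _ => ?_
        rw [hnorm, Finset.mul_sum]
        refine Finset.sum_congr rfl fun x _ => ?_
        rw [Finset.mul_sum]
        refine Finset.sum_congr rfl fun y _ => ?_
        ring
    _ = ∑ x, ∑ y, (∑ σ, w σ * (spinAt x σ * spinAt y σ)) * (torusChar k x * conj (torusChar k y)).re := by
        rw [Finset.sum_comm]
        refine Finset.sum_congr rfl fun x _ => ?_
        rw [Finset.sum_comm]
        refine Finset.sum_congr rfl fun y _ => ?_
        rw [Finset.sum_mul]
    _ = W * (∑ x, ∑ y, (wTwoPoint J β (y - x) : ℂ) * (torusChar k x * conj (torusChar k y))).re := by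
        rw [Complex.re_sum, Finset.mul_sum]
        refine Finset.sum_congr rfl fun x _ => ?_
        rw [Complex.re_sum, Finset.mul_sum]
        refine Finset.sum_congr rfl fun y _ => ?_
        rw [hpair, Complex.re_ofReal_mul]
        ring
    _ = W * ((L : ℝ) ^ d * ∑ z, wTwoPoint J β z * (torusChar k z).re) := by
        rw [hfourier, ← hre]
        congr 1
        rw [show ((L : ℂ) ^ d) = (((L : ℝ) ^ d : ℝ) : ℂ) by push_cast; rfl, Complex.re_ofReal_mul]

/-! #### The infrared bound -/

/-- **The infrared bound for a reflection-positive translation-invariant pair interaction on the even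
torus, with the Fröhlich–Simon–Spencer constant.** For `L` even, `L ≥ 4`, `β > 0`, `j ≥ 0` even,
`J_{x,y} = j(y-x)` invariant under every reflection between sites with positive semidefinite crossing
kernels, and `k` with `E_J(k) > 0`:
`Ŝ⁽ᴸ⁾(p_k) := ∑_{z∈𝕋_L}⟨σ₀σ_z⟩_{J,β}cos(p_k·z) ≤ 1/(βE_J(k))`, `E_J(k) = ∑_wJ_{0,w}(1-cos p_k·w) = |J|(1-Ĵ(p_k))`.
Panis 2023 prints Proposition 3.4 as `Ŝ⁽ᴸ⁾(p) ≤ 1/(2β|J|(1-Ĵ(p)))`; what Gaussian domination gives — and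
what is proved here — is the bound with `β|J|(1-Ĵ(p))` (Friedli–Velenik 2017, Thm. 10.24 for (10.38),
`-2βS_i·S_j` per bond; the printed `2β` fails for the nearest-neighbour chain on `ℤ/2ℤ` at `β = 1/4`).
Proof: `β⟨𝓔_J(σ,h)²⟩ ≤ 𝓔_J(h,h)` for `h = Re χ_k, Im χ_k` (`sum_weight_wGradForm_sq_le`, from
`wGaussZ_le_wGaussZ_zero`), `𝓔_J(σ,χ_k) = E_J(k)Ŝ_k(σ)`, `½∑J‖χ_k(x)-χ_k(y)‖² = L^dE_J(k)`, and
`⟨|Ŝ_k|²⟩ = L^dŜ⁽ᴸ⁾(p_k)`.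
[cite: Panis2023Triviality, Proposition 3.4 and Remark 3.5] [cite: FriedliVelenik2017, Thm. 10.24, proof pp. 506–507] -/
theorem wInfraredBound (hL : Even L) (hL4 : 4 ≤ L) {β : ℝ} (hβ : 0 < β) (hj0 : ∀ w, 0 ≤ j w)
    (hje : ∀ w, j (-w) = j w)
    (hJθ : ∀ (i : Fin d) (c : ZMod L) (x y : TorusSite d L),
      convCoupling j (Torus.reflectBetweenSites i c x) (Torus.reflectBetweenSites i c y) = convCoupling j x y)
    (hK : ∀ (i : Fin d) (c : ZMod L) (u : TorusSite d L → ℝ),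
      0 ≤ ∑ x ∈ (Torus.halfBetweenSites i c).toFinset, ∑ y ∈ (Torus.halfBetweenSites i c).toFinset,
        convCoupling j x (Torus.reflectBetweenSites i c y) * u x * u y)
    (k : TorusSite d L) (hgap : 0 < couplingGap j k) :
    ∑ z, wTwoPoint (convCoupling j) β z * (torusChar k z).re ≤ 1 / (β * couplingGap j k) := by
  classical
  set J := convCoupling j with hJdef
  have hJs : ∀ x y, J x y = J y x := fun x y => by
    simp only [hJdef, convCoupling]
    rw [← hje (y - x), neg_sub]
  have hJnn : ∀ x y, 0 ≤ J x y := fun x y => hj0 _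
  have hGD : ∀ (h : TorusSite d L → ℝ) (t : ℝ), wGaussZ J β (t • h) ≤ wGaussZ J β 0 := fun h t =>
    wGaussZ_le_wGaussZ_zero hL hL4 hβ.le hJs hJθ hK _
  set E : ℝ := couplingGap j k with hE
  -- the two real test functions and the second-order inequalities
  set h₁ : TorusSite d L → ℝ := fun x => (torusChar k x).re with hh₁
  set h₂ : TorusSite d L → ℝ := fun x => (torusChar k x).im with hh₂
  have key₁ := sum_weight_wGradForm_sq_le J hJnn hβ h₁ (hGD h₁)
  have key₂ := sum_weight_wGradForm_sq_le J hJnn hβ h₂ (hGD h₂)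
  set w : SpinConfig (TorusSite d L) → ℝ := wWeight J β with hw
  set W : ℝ := ∑ σ, w σ with hW
  have hWpos : 0 < W := sum_wWeight_pos J β
  -- `A₁² + A₂² = E²‖Ŝ‖²`
  have hA : ∀ σ : SpinConfig (TorusSite d L),
      wGradForm J (fun x => spinAt x σ) h₁ ^ 2 + wGradForm J (fun x => spinAt x σ) h₂ ^ 2 =
        E ^ 2 * ‖spinMode k σ‖ ^ 2 := by
    intro σ
    have hC := wGradFormC_torusChar j hje k σ
    have hre : wGradForm J (fun x => spinAt x σ) h₁ = E * (spinMode k σ).re := by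
      rw [hh₁, ← wGradFormC_re, hJdef, hC, Complex.re_ofReal_mul]
    have him : wGradForm J (fun x => spinAt x σ) h₂ = E * (spinMode k σ).im := by
      rw [hh₂, ← wGradFormC_im, hJdef, hC, Complex.im_ofReal_mul]
    rw [hre, him, ← Complex.normSq_eq_norm_sq, Complex.normSq_apply]
    ring
  -- `B₁ + B₂ = L^d E`
  have hB : wGradForm J h₁ h₁ + wGradForm J h₂ h₂ = (L : ℝ) ^ d * E := by
    rw [hh₁, hh₂, ← wGradNormSq_eq, hJdef, wGradNormSq_torusChar]
  -- add the two inequalities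
  have hS : ∑ σ, w σ * wGradForm J (fun x => spinAt x σ) h₁ ^ 2 +
      ∑ σ, w σ * wGradForm J (fun x => spinAt x σ) h₂ ^ 2 =
        E ^ 2 * ∑ σ, w σ * ‖spinMode k σ‖ ^ 2 := by
    rw [← Finset.sum_add_distrib, Finset.mul_sum]
    refine Finset.sum_congr rfl fun σ _ => ?_
    rw [← mul_add, hA σ]
    ring
  have hsum : β * (E ^ 2 * ∑ σ, w σ * ‖spinMode k σ‖ ^ 2) ≤ (L : ℝ) ^ d * E * W := by
    calc β * (E ^ 2 * ∑ σ, w σ * ‖spinMode k σ‖ ^ 2)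
        = β * ∑ σ, w σ * wGradForm J (fun x => spinAt x σ) h₁ ^ 2 +
            β * ∑ σ, w σ * wGradForm J (fun x => spinAt x σ) h₂ ^ 2 := by
          rw [← hS, mul_add]
      _ ≤ wGradForm J h₁ h₁ * W + wGradForm J h₂ h₂ * W := add_le_add key₁ key₂
      _ = (L : ℝ) ^ d * E * W := by rw [← add_mul, hB]
  rw [hw, hJdef, sum_weight_norm_spinMode_sq_w j β k] at hsum
  -- divide by `L^d E W > 0`
  have hLd : (0 : ℝ) < (L : ℝ) ^ d := by
    have : (0 : ℝ) < L := Nat.cast_pos.2 (Nat.pos_of_ne_zero (NeZero.ne L))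
    positivity
  set R := ∑ z, wTwoPoint (convCoupling j) β z * (torusChar k z).re with hR
  have hW' : (∑ σ, wWeight (convCoupling j) β σ) = W := by rw [hW, hw, hJdef]
  rw [hW'] at hsum
  have h1 : β * (E ^ 2 * (W * ((L : ℝ) ^ d * R))) = ((L : ℝ) ^ d * E * W) * (β * E * R) := by ring
  rw [h1] at hsum
  have hpos : 0 < (L : ℝ) ^ d * E * W := by positivity
  have h2 : β * E * R ≤ 1 := by
    by_contra hcon
    push Not at hcon
    nlinarith
  rw [le_div_iff₀ (by positivity)]
  linarith

end Torus

end Literature.Probability.LatticeModels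

end
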